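import Mathlib
import HarnessLib

/-!
# The fast Fourier transform and fast (nega)cyclic convolution over a commutative ring

Topic `Computability/AlgebraicComplexity`.  The algebraic core of FFT-based multiplication
(von zur Gathen–Gerhard, *Modern Computer Algebra*, §8.2–8.3), over an arbitrary commutative
ring `S`, with sequences modelled as `ℕ → S` read on an initial segment `range t`:

* `dft t ω a k = ∑_{i<t} a i · ω^{ik}` — the discrete Fourier transform;
* `fft k ω a` — the radix-2 *decimation-in-frequency* FFT of length `2^k` (GG Algorithm 8.14:
  `r₀ = ∑ (f_j + f_{j+n/2}) x^j`, `r₁* = ∑ (f_j − f_{j+n/2}) ω^j x^j`, recursion with `ω²`, outputs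
  interleaved), as a structurally recursive function, and **`fft_eq_dft`**: it computes the DFT
  as soon as `ω^{2^{k-1}} = −1` (no primitivity or integrality hypothesis is needed for this);
* `IsPrincipalRoot t ω` (`ω^t = 1` and `∑_{i<t} ω^{im} = 0` for `0 < m < t`) and
  **`IsPrincipalRoot.of_pow_eq_neg_one`**: `ω^{2^k} = −1` makes `ω` a principal `2^{k+1}`-th root
  of unity — over ANY commutative ring (the inverse-DFT argument of GG Thm 8.13/8.15 needs only
  this, not that `ω^{t/2} − 1` be a non-zero-divisor);
* **`dft_dft`**: `DFT_ω (DFT_ω a)_j = t · a_{(−j) mod t}` (inversion up to the index reversal and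
  the factor `t`; no inverse of `ω` is used);
* `cconv`, **`dft_cconv`**: the cyclic convolution theorem `DFT(a ⋆ b) = DFT a · DFT b`
  (GG Lemma 8.11), hence GG Algorithm 8.16 / Thm 8.18 (fast convolution);
* `nconv` (negacyclic = negative wrapped convolution, i.e. multiplication modulo `y^t + 1`) and
  **`cconv_weight`**: with `η^t = −1`, the cyclic convolution of the weighted sequences `η^i a_i`,
  `η^j b_j` is `η^k` times the negacyclic one (the substitution `y ↦ ηy` of GG §8.3, eq. (7));
* `fastNconv` — negacyclic product of length `2^κ` by three FFTs with `ω = η²`, a pointwise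
  product, unweighting and division by `t` — and **`fastNconv_eq_nconv`**, its correctness:
  step 3 of GG Algorithm 8.20 (Schönhage–Strassen) with the ring `D` abstracted to any `S`
  containing `η` with `η^{2^κ} = −1` and an inverse of `2^κ`.

All statements are identities in `S`; operation counts are not formalised here.  This file is
the algebraic layer under the Schönhage–Strassen negacyclic multiplication in `R[x]` (the ring
`D = R[x]/(x^{2m}+1)` with `η` a power of `x`), used for `M_R(d) = O(d log d log log d)`
(Harvey 2021, §2.2, via Kronecker substitution in the source; here directly over `ℤ/Nℤ`).

## References

* J. von zur Gathen, J. Gerhard, *Modern Computer Algebra*, Cambridge University Press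
  (1st ed. 1999; 3rd ed. 2013), §8.2 (Def. of DFT, Lemma 8.11, Algorithm 8.14 and Thm 8.15,
  Algorithm 8.16 and Thm 8.18), §8.3 (Algorithm 8.20, Thm 8.22).  Text of §8.2–8.3 checked on
  the internal scan (panama:448136887664644). [GathenGerhard2013]
* A. Schönhage, V. Strassen, *Schnelle Multiplikation großer Zahlen*, Computing 7 (1971)
  281–292 (the negacyclic FFT trick). [SchonhageStrassen1971]
* D. Harvey, *An exponent one-fifth algorithm for deterministic integer factorisation*,
  Math. Comp. 90 (2021), §2.2 (consumer). [Harvey2021]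
-/

namespace Literature.Computability.AlgebraicComplexity

open Finset

variable {S : Type*} [CommRing S]

/-! ### Two elementary summation lemmas -/

/-- Powers of `ω` only depend on the exponent modulo `t` once `ω ^ t = 1`. [folklore] -/
theorem pow_eq_pow_mod_of_pow_eq_one {ω : S} {t : ℕ} (ht : ω ^ t = 1) (n : ℕ) :
    ω ^ n = ω ^ (n % t) := by
  conv_lhs => rw [← Nat.div_add_mod n t, pow_add, pow_mul, ht, one_pow, one_mul]

/-- Rotating the summation index of a sum over `range t` by `i` (cyclically) does not change the
sum: `∑_{j<t} F ((i + j) mod t) = ∑_{k<t} F k`. [folklore] -/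
theorem sum_range_comp_add_mod (t : ℕ) (F : ℕ → S) :
    ∀ i : ℕ, ∑ j ∈ range t, F ((i + j) % t) = ∑ k ∈ range t, F k := by
  intro i
  induction i generalizing F with
  | zero =>
    refine sum_congr rfl fun j hj => ?_
    rw [zero_add, Nat.mod_eq_of_lt (mem_range.1 hj)]
  | succ i ih =>
    -- rotate by `i` the sequence `k ↦ F ((k + 1) mod t)`, then rotate once more
    have key : ∑ j ∈ range t, F ((i + 1 + j) % t) = ∑ j ∈ range t, F (((i + j) % t + 1) % t) := by
      refine sum_congr rfl fun j _ => ?_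
      rw [Nat.mod_add_mod, show i + 1 + j = i + j + 1 by ring]
    have ih' := ih (fun k => F ((k + 1) % t))
    rw [key, ih']
    -- `∑_{k<t} F ((k+1) mod t) = ∑_{k<t} F k`
    cases t with
    | zero => simp
    | succ s =>
      rw [sum_range_succ, sum_range_succ', Nat.mod_self]
      congr 1
      refine sum_congr rfl fun k hk => ?_
      rw [Nat.mod_eq_of_lt (by have := mem_range.1 hk; omega)]

/-- Splitting a sum over `range (m * t)` into `t` blocks of length `m`. [folklore] -/
theorem sum_range_mul_eq_sum_sum (m : ℕ) (F : ℕ → S) :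
    ∀ t : ℕ, ∑ e ∈ range (m * t), F e = ∑ i ∈ range t, ∑ l ∈ range m, F (m * i + l)
  | 0 => by simp
  | t + 1 => by
    rw [mul_add_one, sum_range_add, sum_range_mul_eq_sum_sum m F t, sum_range_succ]

/-! ### The discrete Fourier transform -/

/-- The **discrete Fourier transform** of length `t` with respect to `ω`:
`dft t ω a k = ∑_{i<t} a i · ω^{i k}` (`= f(ω^k)` for `f = ∑ a_i x^i`; GG §8.2).  Only the
values `a i`, `i < t`, are used; `k` is arbitrary. [cite: GathenGerhard2013, §8.2 (Definition of DFT_ω)] -/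
def dft (t : ℕ) (ω : S) (a : ℕ → S) (k : ℕ) : S :=
  ∑ i ∈ range t, a i * ω ^ (i * k)

/-- `dft` only reads its input below `t`. [folklore] -/
theorem dft_congr {t : ℕ} {ω : S} {a b : ℕ → S} (h : ∀ i < t, a i = b i) (k : ℕ) :
    dft t ω a k = dft t ω b k :=
  sum_congr rfl fun i hi => by rw [h i (mem_range.1 hi)]

/-- `dft` commutes with ring homomorphisms. [folklore] -/
theorem map_dft {S' : Type*} [CommRing S'] (φ : S →+* S') (t : ℕ) (ω : S) (a : ℕ → S) (k : ℕ) :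
    φ (dft t ω a k) = dft t (φ ω) (φ ∘ a) k := by
  simp [dft, map_sum, map_mul, map_pow]

/-- **Decimation in frequency, even outputs** (GG Algorithm 8.14, step 4 with Lemma: `r₀(ω^{2i}) =
f(ω^{2i})`): if `ω^h = −1` … in fact only `ω^{2h} = 1` is used here, which we derive from
`ω^h = −1`. [cite: GathenGerhard2013, §8.2 Algorithm 8.14 / Thm 8.15 (proof)] -/
theorem dft_add_even (h : ℕ) {ω : S} (hω : ω ^ h = -1) (a : ℕ → S) (i : ℕ) :
    dft (h + h) ω a (2 * i) = dft h (ω * ω) (fun l => a l + a (h + l)) i := by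
  unfold dft
  rw [sum_range_add, ← sum_add_distrib]
  refine sum_congr rfl fun l _ => ?_
  have e1 : ω ^ (l * (2 * i)) = (ω * ω) ^ (l * i) := by
    rw [mul_pow, ← pow_add]; congr 1; ring
  have e0 : ω ^ (h * (2 * i)) = 1 := by
    rw [pow_mul, hω, (even_two_mul i).neg_one_pow]
  have e2 : ω ^ ((h + l) * (2 * i)) = (ω * ω) ^ (l * i) := by
    rw [add_mul, pow_add, e0, one_mul, e1]
  rw [e1, e2]; ring

/-- **Decimation in frequency, odd outputs** (GG Algorithm 8.14: `r₁*(ω^{2i}) = f(ω^{2i+1})`),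
for `ω^h = −1`. [cite: GathenGerhard2013, §8.2 Algorithm 8.14 / Thm 8.15 (proof)] -/
theorem dft_add_odd (h : ℕ) {ω : S} (hω : ω ^ h = -1) (a : ℕ → S) (i : ℕ) :
    dft (h + h) ω a (2 * i + 1) = dft h (ω * ω) (fun l => (a l - a (h + l)) * ω ^ l) i := by
  unfold dft
  rw [sum_range_add, ← sum_add_distrib]
  refine sum_congr rfl fun l _ => ?_
  have e1 : ω ^ (l * (2 * i + 1)) = ω ^ l * (ω * ω) ^ (l * i) := by
    rw [mul_pow, ← pow_add, ← pow_add]; congr 1; ring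
  have e0 : ω ^ (h * (2 * i + 1)) = -1 := by
    rw [pow_mul, hω, Odd.neg_one_pow ⟨i, rfl⟩]
  have e2 : ω ^ ((h + l) * (2 * i + 1)) = -(ω ^ l * (ω * ω) ^ (l * i)) := by
    rw [add_mul, pow_add, e0, e1]; ring
  rw [e1, e2]; ring

/-! ### The fast Fourier transform -/

/-- **The FFT** (GG Algorithm 8.14, radix 2, decimation in frequency), as a function: on length
`2^(k+1)`, form `b_l = a_l + a_{h+l}` and `c_l = (a_l − a_{h+l}) ω^l` (`h = 2^k`), transform both
recursively with `ω²`, and interleave (even output `2i` from `b`, odd output `2i+1` from `c`).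
Length `2^0 = 1`: the identity.  Values at indices `≥ 2^k` are junk. [cite: GathenGerhard2013, §8.2 Algorithm 8.14] -/
def fft : ℕ → S → (ℕ → S) → ℕ → S
  | 0, _, a, _ => a 0
  | k + 1, ω, a, j =>
      if j % 2 = 0 then fft k (ω * ω) (fun l => a l + a (2 ^ k + l)) (j / 2)
      else fft k (ω * ω) (fun l => (a l - a (2 ^ k + l)) * ω ^ l) (j / 2)

/-- **Correctness of the FFT** (GG Thm 8.15, correctness part): if `ω ^ 2^(k-1) = −1` (vacuous for
`k = 0`), then `fft k ω a j = dft (2^k) ω a j` for all `j < 2^k`.  Over any commutative ring; no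
primitivity is needed for this direction. [cite: GathenGerhard2013, §8.2 Thm 8.15] -/
theorem fft_eq_dft : ∀ (k : ℕ) (ω : S) (a : ℕ → S), (k ≠ 0 → ω ^ 2 ^ (k - 1) = -1) →
    ∀ j < 2 ^ k, fft k ω a j = dft (2 ^ k) ω a j
  | 0, ω, a, _, j, hj => by
    have : j = 0 := by simpa using hj
    subst this
    simp [fft, dft]
  | k + 1, ω, a, hω, j, hj => by
    have hωk : ω ^ 2 ^ k = -1 := hω (Nat.succ_ne_zero k)
    have hω2 : k ≠ 0 → (ω * ω) ^ 2 ^ (k - 1) = -1 := by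
      intro hk
      rw [mul_pow, ← pow_add, ← two_mul, ← pow_succ', Nat.sub_add_cancel (Nat.one_le_iff_ne_zero.2 hk)]
      exact hωk
    have hlen : 2 ^ (k + 1) = 2 ^ k + 2 ^ k := by rw [pow_succ, mul_two]
    have hj2 : j / 2 < 2 ^ k := by omega
    rcases Nat.even_or_odd j with ⟨i, rfl⟩ | ⟨i, rfl⟩
    · have hi : (i + i) / 2 = i := by omega
      have hmod : (i + i) % 2 = 0 := by omega
      rw [fft, if_pos hmod, hi, fft_eq_dft k _ _ hω2 i (by omega), hlen,
        show i + i = 2 * i by ring, dft_add_even _ hωk]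
    · have hi : (2 * i + 1) / 2 = i := by omega
      have hmod : (2 * i + 1) % 2 ≠ 0 := by omega
      rw [fft, if_neg hmod, hi, fft_eq_dft k _ _ hω2 i (by omega), hlen, dft_add_odd _ hωk]

/-! ### Principal roots of unity and inversion -/

/-- `ω` is a **principal `t`-th root of unity**: `ω^t = 1` and `∑_{i<t} ω^{im} = 0` for every
`0 < m < t`.  (This is what the inversion formula needs; over an integral domain it is implied by
primitivity, GG §8.2.) [folklore] -/
structure IsPrincipalRoot (t : ℕ) (ω : S) : Prop where
  /-- `ω ^ t = 1`. -/
  pow_eq_one : ω ^ t = 1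
  /-- The power sums over a full period vanish off the trivial character. -/
  sum_eq_zero : ∀ m, 0 < m → m < t → ∑ i ∈ range t, ω ^ (i * m) = 0

/-- **Powers of two: `ω ^ 2^k = −1` makes `ω` a principal `2^(k+1)`-th root of unity, over any
commutative ring.**  Proof by induction on `k`: splitting the sum in two halves gives the factor
`1 + (−1)^m`, which vanishes for odd `m`; for even `m = 2m'` the sum is the one for `ω²` and `m'`.
(GG §8.3 uses that `ω^{n} − 1 = −2` is a unit when `2` is; the present statement needs no
hypothesis on `2`.) [folklore] -/
theorem IsPrincipalRoot.of_pow_eq_neg_one :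
    ∀ (k : ℕ) {ω : S}, ω ^ 2 ^ k = -1 → IsPrincipalRoot (2 ^ (k + 1)) ω := by
  intro k
  induction k with
  | zero =>
    intro ω hω
    have hω' : ω = -1 := by simpa using hω
    refine ⟨by norm_num [hω'], fun m hm0 hmt => ?_⟩
    have hm : m = 1 := by
      have : m < 2 := by simpa using hmt
      omega
    subst hm
    norm_num [sum_range_succ, hω']
  | succ k ih =>
    intro ω hω
    have hlen : 2 ^ (k + 1 + 1) = 2 ^ (k + 1) + 2 ^ (k + 1) := by rw [pow_succ, mul_two]
    have hsq : (ω * ω) ^ 2 ^ k = -1 := by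
      rw [mul_pow, ← pow_add, ← mul_two, ← pow_succ]; exact hω
    have hωt : ω ^ 2 ^ (k + 1 + 1) = 1 := by
      rw [hlen, pow_add, hω]; norm_num
    refine ⟨hωt, fun m hm0 hmt => ?_⟩
    have hsplit : ∑ i ∈ range (2 ^ (k + 1 + 1)), ω ^ (i * m) =
        (1 + (-1) ^ m) * ∑ i ∈ range (2 ^ (k + 1)), ω ^ (i * m) := by
      rw [hlen, sum_range_add, one_add_mul, mul_sum]
      congr 1
      refine sum_congr rfl fun i _ => ?_
      rw [add_mul, pow_add, pow_mul, hω]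
    rw [hsplit]
    rcases Nat.even_or_odd m with ⟨m', rfl⟩ | ho
    · have hm'0 : 0 < m' := by omega
      have hm't : m' < 2 ^ (k + 1) := by omega
      have key := (ih hsq).sum_eq_zero m' hm'0 hm't
      have : ∑ i ∈ range (2 ^ (k + 1)), ω ^ (i * (m' + m')) = 0 := by
        rw [← key]
        refine sum_congr rfl fun i _ => ?_
        rw [mul_pow, ← pow_add, mul_add]
      rw [this, mul_zero]
    · rw [ho.neg_one_pow]; simp

/-- For a principal root, the full-period power sum at exponent `n` is `t` if `t ∣ n` and `0`
otherwise. [folklore] -/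
theorem IsPrincipalRoot.sum_pow_mul {t : ℕ} {ω : S} (hω : IsPrincipalRoot t ω) (n : ℕ) :
    ∑ i ∈ range t, ω ^ (i * n) = if n % t = 0 then (t : S) else 0 := by
  have hper : ∀ i, ω ^ (i * n) = ω ^ (i * (n % t)) := by
    intro i
    rw [Nat.mul_comm i n, pow_mul, pow_eq_pow_mod_of_pow_eq_one hω.pow_eq_one n, ← pow_mul,
      Nat.mul_comm (n % t) i]
  simp_rw [hper]
  split_ifs with h
  · simp [h]
  · rcases Nat.eq_zero_or_pos t with rfl | ht
    · simp
    · exact hω.sum_eq_zero _ (Nat.pos_of_ne_zero h) (Nat.mod_lt _ ht)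

/-- The index `(t - j) mod t` is the unique `i < t` with `t ∣ i + j` (for `j < t`). [folklore] -/
theorem add_mod_eq_zero_iff_eq_sub_mod {t i j : ℕ} (hi : i < t) (hj : j < t) :
    (i + j) % t = 0 ↔ i = (t - j) % t := by
  constructor
  · intro h
    obtain ⟨c, hc⟩ := Nat.dvd_of_mod_eq_zero h
    have hc2 : c < 2 := by
      by_contra hc2
      have : t * 2 ≤ t * c := Nat.mul_le_mul_left t (by omega)
      linarith
    interval_cases c
    · have hi0 : i = 0 := by omega
      have hj0 : j = 0 := by omega
      subst hi0; subst hj0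
      simp
    · have hj0 : 0 < j := by
        rcases Nat.eq_zero_or_pos j with rfl | hj0
        · omega
        · exact hj0
      rw [Nat.mod_eq_of_lt (by omega)]
      omega
  · rintro rfl
    rcases Nat.eq_zero_or_pos j with rfl | hj0
    · simp
    · rw [Nat.mod_eq_of_lt (show t - j < t by omega), Nat.sub_add_cancel hj.le, Nat.mod_self]

/-- **Inversion of the DFT** (GG Thm 8.13 in reversal form): for a principal `t`-th root `ω` and
`j < t`, `DFT_ω(DFT_ω(a))_j = t · a_{(t-j) mod t}`.  Hence `DFT_ω⁻¹ = t⁻¹ · (reversal ∘ DFT_ω)`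
whenever `t` is invertible; no inverse of `ω` is needed. [cite: GathenGerhard2013, §8.2 Thm 8.13] -/
theorem dft_dft {t : ℕ} {ω : S} (hω : IsPrincipalRoot t ω) (a : ℕ → S) {j : ℕ} (hj : j < t) :
    dft t ω (dft t ω a) j = (t : S) * a ((t - j) % t) := by
  have ht : 0 < t := lt_of_le_of_lt (Nat.zero_le j) hj
  unfold dft
  -- exchange the sums
  have step1 : ∑ k ∈ range t, (∑ i ∈ range t, a i * ω ^ (i * k)) * ω ^ (k * j) =
      ∑ i ∈ range t, a i * ∑ k ∈ range t, ω ^ (k * (i + j)) := by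
    simp_rw [sum_mul, mul_sum]
    rw [sum_comm]
    refine sum_congr rfl fun i _ => sum_congr rfl fun k _ => ?_
    rw [mul_assoc, ← pow_add]; congr 2; ring
  rw [step1]
  simp_rw [hω.sum_pow_mul]
  rw [sum_eq_single ((t - j) % t)]
  · rw [if_pos ((add_mod_eq_zero_iff_eq_sub_mod (Nat.mod_lt _ ht) hj).2 rfl), mul_comm]
  · intro i hi hne
    rw [if_neg (fun h => hne ((add_mod_eq_zero_iff_eq_sub_mod (mem_range.1 hi) hj).1 h)),
      mul_zero]
  · intro h; exact absurd (mem_range.2 (Nat.mod_lt _ ht)) h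

/-! ### Cyclic convolution -/

/-- The **cyclic convolution** of length `t` (multiplication modulo `y^t − 1`):
`(a ⋆ b)_k = ∑_{i<t} a_i b_{(k-i) mod t}` (written with `k + (t - i)` to stay in `ℕ`). [cite: GathenGerhard2013, §8.2 (convolution, Lemma 8.11)] -/
def cconv (t : ℕ) (a b : ℕ → S) (k : ℕ) : S :=
  ∑ i ∈ range t, a i * b ((k + (t - i)) % t)

/-- **The cyclic convolution theorem** (GG Lemma 8.11): `DFT_ω(a ⋆ b) = DFT_ω(a) · DFT_ω(b)`
pointwise, for any `ω` with `ω^t = 1`. [cite: GathenGerhard2013, §8.2 Lemma 8.11] -/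
theorem dft_cconv {t : ℕ} {ω : S} (ht : ω ^ t = 1) (a b : ℕ → S) (l : ℕ) :
    dft t ω (cconv t a b) l = dft t ω a l * dft t ω b l := by
  unfold dft cconv
  rw [sum_mul_sum]
  simp_rw [sum_mul]
  conv_lhs => rw [sum_comm]
  refine sum_congr rfl fun i hi => ?_
  have hi' := mem_range.1 hi
  -- rotate the inner sum by `i`
  have rot := sum_range_comp_add_mod t (fun k => a i * b ((k + (t - i)) % t) * ω ^ (k * l)) i
  rw [← rot]
  refine sum_congr rfl fun j hj => ?_
  have hj' := mem_range.1 hj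
  have e1 : ((i + j) % t + (t - i)) % t = j := by
    rw [Nat.mod_add_mod, show i + j + (t - i) = j + t by omega, Nat.add_mod_right,
      Nat.mod_eq_of_lt hj']
  have e2 : ω ^ ((i + j) % t * l) = ω ^ (i * l) * ω ^ (j * l) := by
    rw [pow_mul, ← pow_eq_pow_mod_of_pow_eq_one ht, ← pow_mul, add_mul, pow_add]
  rw [e1, e2]; ring

/-! ### Negacyclic convolution by weighting -/

/-- The **negacyclic (negative wrapped) convolution** of length `t`, i.e. the coefficients of the
product modulo `y^t + 1`: `(a ⊛ b)_k = ∑_{i ≤ k} a_i b_{k-i} − ∑_{k < i < t} a_i b_{k+t-i}`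
(meaningful for `k < t`). [cite: GathenGerhard2013, §8.3 (negative wrapped convolution)] -/
def nconv (t : ℕ) (a b : ℕ → S) (k : ℕ) : S :=
  ∑ i ∈ range (k + 1), a i * b (k - i) - ∑ i ∈ Ico (k + 1) t, a i * b (k + t - i)

/-- `nconv` commutes with ring homomorphisms. [folklore] -/
theorem map_nconv {S' : Type*} [CommRing S'] (φ : S →+* S') (t : ℕ) (a b : ℕ → S) (k : ℕ) :
    φ (nconv t a b k) = nconv t (φ ∘ a) (φ ∘ b) k := by
  simp [nconv, map_sum, map_mul, map_sub]

/-- `nconv t` only reads its inputs below `t` (for `k < t`). [folklore] -/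
theorem nconv_congr {t : ℕ} {a a' b b' : ℕ → S} (ha : ∀ i < t, a i = a' i)
    (hb : ∀ i < t, b i = b' i) {k : ℕ} (hk : k < t) : nconv t a b k = nconv t a' b' k := by
  unfold nconv
  congr 1
  · refine sum_congr rfl fun i hi => ?_
    have := mem_range.1 hi
    rw [ha i (by omega), hb (k - i) (by omega)]
  · refine sum_congr rfl fun i hi => ?_
    have := (mem_Ico.1 hi)
    rw [ha i (by omega), hb (k + t - i) (by omega)]

/-- **Weighting turns negacyclic into cyclic convolution** (GG §8.3, eq. (7): substitute
`y ↦ ηy` with `η^t = −1`): for `k < t`,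
`cconv t (η^i a_i) (η^j b_j) k = η^k · nconv t a b k`. [cite: GathenGerhard2013, §8.3 eq. (7)] -/
theorem cconv_weight {t : ℕ} {η : S} (hη : η ^ t = -1) (a b : ℕ → S) {k : ℕ} (hk : k < t) :
    cconv t (fun i => η ^ i * a i) (fun j => η ^ j * b j) k = η ^ k * nconv t a b k := by
  unfold cconv nconv
  rw [← sum_range_add_sum_Ico _ (show k + 1 ≤ t from hk), mul_sub, mul_sum, mul_sum,
    sub_eq_add_neg]
  congr 1
  · refine sum_congr rfl fun i hi => ?_
    have hi' : i ≤ k := Nat.lt_succ_iff.1 (mem_range.1 hi)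
    have e : (k + (t - i)) % t = k - i := by
      rw [show k + (t - i) = (k - i) + t by omega, Nat.add_mod_right, Nat.mod_eq_of_lt (by omega)]
    rw [e]
    have : η ^ i * η ^ (k - i) = η ^ k := by rw [← pow_add, Nat.add_sub_cancel' hi']
    calc η ^ i * a i * (η ^ (k - i) * b (k - i))
        = η ^ i * η ^ (k - i) * (a i * b (k - i)) := by ring
      _ = η ^ k * (a i * b (k - i)) := by rw [this]
  · rw [← sum_neg_distrib]
    refine sum_congr rfl fun i hi => ?_
    obtain ⟨hi1, hi2⟩ := mem_Ico.1 hi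
    have e : (k + (t - i)) % t = k + t - i := by
      rw [Nat.mod_eq_of_lt (by omega)]; omega
    rw [e]
    have : η ^ i * η ^ (k + t - i) = -η ^ k := by
      rw [← pow_add, show i + (k + t - i) = k + t by omega, pow_add, hη]; ring
    calc η ^ i * a i * (η ^ (k + t - i) * b (k + t - i))
        = η ^ i * η ^ (k + t - i) * (a i * b (k + t - i)) := by ring
      _ = -(η ^ k * (a i * b (k + t - i))) := by rw [this]; ring

/-! ### Fast negacyclic convolution (three FFTs) -/

/-- **Fast negacyclic convolution of length `t = 2^κ`** (GG Algorithm 8.16 inside step 3 of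
Algorithm 8.20): weight by powers of `η`, two forward FFTs with `ω = η²`, pointwise product, a
third FFT read backwards (= `t ·` inverse DFT), unweight by `η^{2t-k} = η^{-k}`, multiply by
`tinv = t⁻¹`. [cite: GathenGerhard2013, §8.3 Algorithm 8.20 step 3] -/
def fastNconv (κ : ℕ) (η tinv : S) (a b : ℕ → S) (k : ℕ) : S :=
  tinv * η ^ (2 * 2 ^ κ - k) *
    fft κ (η * η)
      (fun l => fft κ (η * η) (fun i => η ^ i * a i) l * fft κ (η * η) (fun i => η ^ i * b i) l)
      ((2 ^ κ - k) % 2 ^ κ)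

/-- **Correctness of the fast negacyclic convolution** (the algebraic content of GG Thm 8.22,
step 3): if `η ^ 2^κ = −1` and `tinv · 2^κ = 1` in `S`, then `fastNconv κ η tinv a b k` is the
negacyclic convolution `nconv (2^κ) a b k` for every `k < 2^κ`.  Ingredients: `fft_eq_dft`
(`ω = η²` satisfies `ω^{t/2} = −1`), `dft_cconv`, `dft_dft` with
`IsPrincipalRoot.of_pow_eq_neg_one`, and `cconv_weight`. [cite: GathenGerhard2013, §8.3 Thm 8.22] -/
theorem fastNconv_eq_nconv {κ : ℕ} {η tinv : S} (hη : η ^ 2 ^ κ = -1)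
    (htinv : tinv * (2 ^ κ : ℕ) = 1) (a b : ℕ → S) {k : ℕ} (hk : k < 2 ^ κ) :
    fastNconv κ η tinv a b k = nconv (2 ^ κ) a b k := by
  rcases Nat.eq_zero_or_pos κ with rfl | hκ
  · -- length 1: everything is a product of the two constant terms
    have hk0 : k = 0 := by simpa using hk
    subst hk0
    have hη1 : η = -1 := by simpa using hη
    have ht1 : tinv = 1 := by simpa using htinv
    simp [fastNconv, fft, nconv, hη1, ht1]
  have hωhalf : κ ≠ 0 → (η * η) ^ 2 ^ (κ - 1) = -1 := by
    intro _
    rw [mul_pow, ← pow_add, ← mul_two, ← pow_succ, Nat.sub_add_cancel hκ]; exact hη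
  have hprinc : IsPrincipalRoot (2 ^ κ) (η * η) := by
    have h := IsPrincipalRoot.of_pow_eq_neg_one (κ - 1) (hωhalf hκ.ne')
    rwa [Nat.sub_add_cancel hκ] at h
  have htpos : 0 < 2 ^ κ := by positivity
  have hidx : (2 ^ κ - k) % 2 ^ κ < 2 ^ κ := Nat.mod_lt _ htpos
  -- the pointwise products are the DFT of the cyclic convolution of the weighted inputs
  have hC : ∀ l < 2 ^ κ,
      fft κ (η * η) (fun i => η ^ i * a i) l * fft κ (η * η) (fun i => η ^ i * b i) l =
        dft (2 ^ κ) (η * η) (cconv (2 ^ κ) (fun i => η ^ i * a i) (fun i => η ^ i * b i)) l := by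
    intro l hl
    rw [fft_eq_dft κ _ _ hωhalf l hl, fft_eq_dft κ _ _ hωhalf l hl, dft_cconv hprinc.pow_eq_one]
  have hE : dft (2 ^ κ) (η * η)
      (fun l => fft κ (η * η) (fun i => η ^ i * a i) l * fft κ (η * η) (fun i => η ^ i * b i) l)
      ((2 ^ κ - k) % 2 ^ κ) = dft (2 ^ κ) (η * η)
      (dft (2 ^ κ) (η * η) (cconv (2 ^ κ) (fun i => η ^ i * a i) (fun i => η ^ i * b i)))
      ((2 ^ κ - k) % 2 ^ κ) :=
    dft_congr hC _
  have h1 : ((2 ^ κ - k) % 2 ^ κ + k) % 2 ^ κ = 0 :=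
    (add_mod_eq_zero_iff_eq_sub_mod hidx hk).2 rfl
  have hrev : (2 ^ κ - (2 ^ κ - k) % 2 ^ κ) % 2 ^ κ = k := by
    rw [add_comm] at h1
    exact ((add_mod_eq_zero_iff_eq_sub_mod hk hidx).1 h1).symm
  have h2t : η ^ (2 * 2 ^ κ - k) * η ^ k = 1 := by
    rw [← pow_add, Nat.sub_add_cancel (by omega), mul_comm, pow_mul, hη]; norm_num
  unfold fastNconv
  rw [fft_eq_dft κ _ _ hωhalf _ hidx, hE, dft_dft hprinc _ hidx, hrev, cconv_weight hη a b hk]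
  calc tinv * η ^ (2 * 2 ^ κ - k) * (((2 ^ κ : ℕ) : S) * (η ^ k * nconv (2 ^ κ) a b k))
      = tinv * ((2 ^ κ : ℕ) : S) * (η ^ (2 * 2 ^ κ - k) * η ^ k) * nconv (2 ^ κ) a b k := by
        ring
    _ = nconv (2 ^ κ) a b k := by rw [h2t, htinv]; ring

end Literature.Computability.AlgebraicComplexity
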